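import Mathlib

/-!
# Generic non-vanishing of a multilinear map: the zero set meets every line in a non-vanishing
direction in finitely many points; the non-vanishing locus is dense

Kernel form of the «generic choice» sentence of the cell's Tier-5 record (route/T5-N0-p5.md (N0.2)(q3)
and (N0.P2)(q3), quoting T4-A3 Lemma A7.3(b) = route-3 T4A Lemma 11.2): «`I_{τ₁}` is multilinear in
`(φ_i, q_i)`, so the set of choices where it is non-zero is either empty or the complement of a proper
Zariski-closed set; hence exhibiting ONE non-vanishing choice proves (N) in the generic sense».

What is proved here, from Mathlib alone, for a multilinear form `f : MultilinearMap K M K` on a finite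
product of `K`-modules (`K` a field):

* `apply_add_smul` — the expansion of `f (v + t • w)` along the line through `v` in the direction `w`:
  `f (v + t • w) = ∑ s, t ^ #sᶜ * f (sᶜ.piecewise w v)`, a polynomial in `t` of degree `≤ #ι` whose top
  coefficient is `f w`.
* `finite_setOf_apply_add_smul_eq_zero` — if `f w ≠ 0`, the set `{t | f (v + t • w) = 0}` is FINITE for
  every base point `v` (the zero set of `f` meets every line in a non-vanishing direction in at most `#ι`
  points).
* `exists_apply_add_smul_ne_zero`, `infinite_setOf_apply_add_smul_ne_zero` — over an infinite field
  (e.g. `ℚ`, the field of the record) every such line carries infinitely many non-vanishing points.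
* `exists_norm_lt_apply_add_smul_ne_zero`, `dense_setOf_apply_ne_zero` — over a nontrivially normed
  field (`ℝ`, `ℂ`) the non-vanishing points on the line come arbitrarily close to `v`, so the
  non-vanishing locus `{m | f m ≠ 0}` of a non-zero multilinear form is DENSE; with continuity
  (`isOpen_setOf_apply_ne_zero`, for a `ContinuousMultilinearMap`) it is open and dense.

This is the «either empty or generic» alternative in its analytic form: the non-vanishing locus of a
multilinear form is empty (`f = 0`) or dense, and its complement contains no line in a non-vanishing
direction.  Nothing about the surface `S`, the morphisms `f_i`, the Schwartz data or the period `I_{τ₁}`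
is asserted; the multilinearity of `I_{τ₁}` in the choices stays the prose's [P] (p7's `T5Quantifier`
carries the «`≠ 0` somewhere ⟺ the multilinear map `≠ 0`» half).  Mathlib only; no definitions.
-/

namespace Summit.Ventures.HodgeRepro2.T5MultilinearGeneric

open Polynomial

section Field

variable {ι : Type*} [Fintype ι] [DecidableEq ι] {K : Type*} [Field K]
  {M : ι → Type*} [∀ i, AddCommGroup (M i)] [∀ i, Module K (M i)]

/-- Expansion of a multilinear form along a line: `f (v + t • w) = ∑ s, t ^ #sᶜ * f (sᶜ.piecewise w v)`. -/
theorem apply_add_smul (f : MultilinearMap K M K) (v w : ∀ i, M i) (t : K) :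
    f (v + t • w) = ∑ s : Finset ι, t ^ sᶜ.card * f (sᶜ.piecewise w v) := by
  rw [MultilinearMap.map_add_univ]
  refine Finset.sum_congr rfl fun s _ => ?_
  have h1 : s.piecewise v (t • w) =
      sᶜ.piecewise (fun i => t • (sᶜ.piecewise w v) i) (sᶜ.piecewise w v) := by
    funext i
    by_cases hi : i ∈ s
    · simp [Finset.piecewise, hi]
    · simp [Finset.piecewise, hi]
  rw [h1, MultilinearMap.map_piecewise_smul, Finset.prod_const, smul_eq_mul]

/-- If `f w ≠ 0`, the zero set of `f` meets the line `{v + t • w}` in finitely many points. -/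
theorem finite_setOf_apply_add_smul_eq_zero (f : MultilinearMap K M K) (v w : ∀ i, M i)
    (hw : f w ≠ 0) : {t : K | f (v + t • w) = 0}.Finite := by
  classical
  let P : K[X] := ∑ s : Finset ι, C (f (sᶜ.piecewise w v)) * X ^ sᶜ.card
  have hP : ∀ t, P.eval t = f (v + t • w) := by
    intro t
    rw [apply_add_smul]
    simp only [P, eval_finsetSum, eval_mul, eval_C, eval_pow, eval_X]
    exact Finset.sum_congr rfl fun s _ => mul_comm _ _
  have hcoeff : P.coeff (Fintype.card ι) = f w := by
    simp only [P, finsetSum_coeff, coeff_C_mul_X_pow]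
    rw [Finset.sum_eq_single (∅ : Finset ι)]
    · rw [if_pos (by simp), Finset.compl_empty, Finset.piecewise_univ]
    · intro s _ hs
      rw [if_neg]
      intro h
      apply hs
      have h2 : sᶜ = Finset.univ := (Finset.card_eq_iff_eq_univ _).1 h.symm
      simpa using h2
    · intro h
      exact absurd (Finset.mem_univ _) h
  have hP0 : P ≠ 0 := by
    intro h0
    rw [h0, coeff_zero] at hcoeff
    exact hw hcoeff.symm
  have hset : {t : K | f (v + t • w) = 0} = {t | IsRoot P t} := by
    ext t
    simp [IsRoot, hP]
  rw [hset]
  exact Polynomial.finite_setOf_isRoot hP0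

/-- Over an infinite field, a line in a non-vanishing direction carries a non-vanishing point. -/
theorem exists_apply_add_smul_ne_zero [Infinite K] (f : MultilinearMap K M K) (v w : ∀ i, M i)
    (hw : f w ≠ 0) : ∃ t : K, f (v + t • w) ≠ 0 := by
  by_contra h
  have h' : ∀ t : K, f (v + t • w) = 0 := fun t => by
    by_contra ht
    exact h ⟨t, ht⟩
  have hall : {t : K | f (v + t • w) = 0} = Set.univ := Set.eq_univ_of_forall h'
  have hfin := finite_setOf_apply_add_smul_eq_zero f v w hw
  rw [hall] at hfin
  exact Set.infinite_univ hfin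

/-- Over an infinite field, a line in a non-vanishing direction carries infinitely many
non-vanishing points. -/
theorem infinite_setOf_apply_add_smul_ne_zero [Infinite K] (f : MultilinearMap K M K)
    (v w : ∀ i, M i) (hw : f w ≠ 0) : {t : K | f (v + t • w) ≠ 0}.Infinite := by
  have hfin := finite_setOf_apply_add_smul_eq_zero f v w hw
  have hset : {t : K | f (v + t • w) ≠ 0} = {t : K | f (v + t • w) = 0}ᶜ := by
    ext t
    simp
  rw [hset]
  exact hfin.infinite_compl

end Field

section Normed

variable {ι : Type*} [Fintype ι] [DecidableEq ι] {K : Type*} [NontriviallyNormedField K]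
  {M : ι → Type*} [∀ i, NormedAddCommGroup (M i)] [∀ i, NormedSpace K (M i)]

/-- In a nontrivially normed field every ball around `0` is infinite. -/
theorem infinite_setOf_norm_lt {ε : ℝ} (hε : 0 < ε) : {t : K | ‖t‖ < ε}.Infinite := by
  obtain ⟨x, hx0, hx1⟩ := NormedField.exists_norm_lt K (lt_min hε one_pos)
  have hxε : ‖x‖ < ε := lt_of_lt_of_le hx1 (min_le_left _ _)
  have hx1' : ‖x‖ < 1 := lt_of_lt_of_le hx1 (min_le_right _ _)
  have hinj : Function.Injective fun n : ℕ => x ^ (n + 1) := by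
    intro m n hmn
    have h := congrArg norm hmn
    simp only [norm_pow] at h
    have h2 := (pow_right_strictAnti₀ hx0 hx1').injective h
    exact Nat.succ_injective h2
  refine Set.infinite_of_injective_forall_mem hinj fun n => ?_
  show ‖x ^ (n + 1)‖ < ε
  rw [norm_pow]
  calc ‖x‖ ^ (n + 1) ≤ ‖x‖ := pow_le_of_le_one hx0.le hx1'.le (Nat.succ_ne_zero n)
    _ < ε := hxε

/-- Over a nontrivially normed field the non-vanishing points on a line in a non-vanishing direction
come arbitrarily close to the base point. -/
theorem exists_norm_lt_apply_add_smul_ne_zero (f : MultilinearMap K M K) (v w : ∀ i, M i)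
    (hw : f w ≠ 0) {ε : ℝ} (hε : 0 < ε) : ∃ t : K, ‖t‖ < ε ∧ f (v + t • w) ≠ 0 := by
  by_contra h
  have h' : ∀ t : K, ‖t‖ < ε → f (v + t • w) = 0 := fun t ht => by
    by_contra hne
    exact h ⟨t, ht, hne⟩
  have hsub : {t : K | ‖t‖ < ε} ⊆ {t : K | f (v + t • w) = 0} := fun t ht => h' t ht
  exact infinite_setOf_norm_lt hε ((finite_setOf_apply_add_smul_eq_zero f v w hw).subset hsub)

/-- **The non-vanishing locus of a non-zero multilinear form is dense.** -/
theorem dense_setOf_apply_ne_zero (f : MultilinearMap K M K) (hf : f ≠ 0) :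
    Dense {m : ∀ i, M i | f m ≠ 0} := by
  obtain ⟨w, hw⟩ : ∃ w, f w ≠ 0 := by
    by_contra h
    have h' : ∀ w, f w = 0 := fun w => by
      by_contra hne
      exact h ⟨w, hne⟩
    exact hf (MultilinearMap.ext h')
  rw [Metric.dense_iff]
  intro v r hr
  have hpos : 0 < r / (‖w‖ + 1) := by positivity
  obtain ⟨t, ht, hne⟩ := exists_norm_lt_apply_add_smul_ne_zero f v w hw hpos
  refine ⟨v + t • w, ?_, hne⟩
  rw [Metric.mem_ball, dist_eq_norm, add_sub_cancel_left, norm_smul]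
  have hw1 : 0 < ‖w‖ + 1 := by positivity
  calc ‖t‖ * ‖w‖ ≤ ‖t‖ * (‖w‖ + 1) := by
        apply mul_le_mul_of_nonneg_left _ (norm_nonneg t)
        linarith
    _ < r / (‖w‖ + 1) * (‖w‖ + 1) := by
        apply mul_lt_mul_of_pos_right ht hw1
    _ = r := by field_simp

omit [Fintype ι] [DecidableEq ι] in
/-- The non-vanishing locus of a continuous multilinear map is open. -/
theorem isOpen_setOf_apply_ne_zero (f : ContinuousMultilinearMap K M K) :
    IsOpen {m : ∀ i, M i | f m ≠ 0} :=
  isOpen_ne_fun f.cont continuous_const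

/-- **Open and dense**: for a non-zero continuous multilinear form the non-vanishing locus is open
and dense — the analytic form of «non-vanishing for ONE choice ⟹ non-vanishing for a generic choice». -/
theorem isOpen_and_dense_setOf_apply_ne_zero (f : ContinuousMultilinearMap K M K)
    (hf : f.toMultilinearMap ≠ 0) :
    IsOpen {m : ∀ i, M i | f m ≠ 0} ∧ Dense {m : ∀ i, M i | f m ≠ 0} :=
  ⟨isOpen_setOf_apply_ne_zero f, dense_setOf_apply_ne_zero f.toMultilinearMap hf⟩

end Normed

end Summit.Ventures.HodgeRepro2.T5MultilinearGeneric
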